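import Literature.AnabelianGeometry.EtaleTheta.Discharge.Sec2Prop214iiiBiInversionOfModel

/-!
# [EtTh] Prop 2.14 (iii), BI-theta case, UPPER bound `Im_N ⊆ (N†·l·ℤ) ⋊ {±1}` — the arithmetic core over §1
# (root cocycles exactly invariant mod `N` on the geometric part; proof-only companion)

Mochizuki, *The Étale Theta Function and its Frobenioid-theoretic Manifestations* [EtTh], Publ. RIMS 45
(2009), §2, Prop 2.14 (iii) pp.49–51 over §1 Prop 1.5 p.23 (locators `p.N` = PDF pages of the PRIMS text;
bib key `MochizukiEtTh2009`). PROOF-ONLY companion (no `def`; seat abc-iut-L2-t2, §2 owner, row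
«P214iii-BI-UPPER», part 1 of 2) over abc-iut-L2-t8's §1 instantiation of `X̲̲` (`DoubleUnderline`, `rootCocycles`,
`CyclotomeMod`) and abc-iut-L2-t1's `ThetaCohomology.lean` (`Prop15ii`, `Prop15iii`); part 2
(`Sec2Prop214iiiBiUpperOfModel.lean`) feeds it from an automorphism of the model bi-theta environment.

PRINT (p.51): "the fact that `Im_N ⊆ (N†·l·ℤ) ⋊ {±1}` follows immediately by considering, in light of the
cohomology computation of Proposition 1.5, (i), the third displayed formula of Proposition 1.4, (ii), applied
to the 'mod `N` étale theta function', which implies [cf. the computation applied in the proof of assertion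
(ii)] that for any `a·l ∈ Im_N` [where `a ∈ ℤ`], we have `2a ≡ 0 (mod N)`."

* `EtaleThetaData.conj_etaDd_div_eq_infl_logUdd` — `σ·η̈^Θ − (xσ)·η̈^Θ = infl(2b·log(Ü) + log(w))` in
  `H¹(Π^tp_Ÿ, Δ_Θ)`, `w ∈ K̈^×`, `b` the image of `x` in `Z` (Prop 1.5 (iii) at `σ` and at `xσ`: "`η̈^Θ ↦ η̈^Θ −
  2a·log(Ü) − (a²/2)·log(q_X) + log(O^×_K̈)`"; the `Ÿ`-form of abc-iut-L2-t10's `conj_etaDd_div_eq`).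
* **`DoubleUnderline.dvd_two_mul_zExp_of_red_conj_eq`** — for a cocycle `f` of `η̲̈^{Θ,l·ℤ×μ₂}` and
  `x ∈ Π^tp_X̲̲` with image `a·l` in `Z`: IF `red ∘ f` is EXACTLY `x`-invariant on the geometric part `Δ^tp_Ÿ̲̲`
  (`red(x̄·f(x⁻¹ g x)·x̄⁻¹) = red(f(g))`), THEN `N ∣ 2a`. Writing `f = (σ·F)|·∂b` with `F` a cocycle of `η̈^Θ`
  (Def 2.7: the collection is the `Π^tp_X̲̲`-orbit; this seat's `exists_eq_conj_mul_cob_of_rootCocycle`), the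
  quotient `(σ·F)/(xσ·F)` has class `infl(2al·log(Ü) + log(w))` (the factor `l` of "`l·ℤ`", p.50), while
  coboundaries and Kummer classes (`F̈²`, Prop 1.5 (ii)) vanish POINTWISE on `Δ^tp_Ÿ` — so
  `log(Ü)(ḡ)^{2al} ∈ N·(l·Δ_Θ)` for every `g ∈ Δ^tp_Ÿ̲̲`, i.e. `red(l·log(Ü)(ḡ))^{2a} = 1` in `μ_N ≅ ℤ/Nℤ`; as
  `red ∘ (l·log(Ü))` maps `Δ^tp_Ÿ̲̲` ONTO `μ_N` (binder `hU`), `N ∣ 2a`.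
* `ndag_mul_dvd_toZ_of_dvd_two_mul_zExp` — the `N†` form of the typed `RigidData.Prop214_iii_bi`
  ("`Ndag * l ∣ s`"): `N ∣ 2a ⇒ N†·l ∣ a·l`, `N† = N` (`N` odd), `N/2` (`N` even).
* `red_pow_logUdd_surjective_of_logUdd_surjective` — the binder `hU` from its `N`-free form "`log(Ü)` maps
  `Δ^tp_Ÿ̲̲` onto `Δ_Θ`".

BINDERS (named, BY NAME; nothing smuggled): `Prop15iii`, `Prop15ii` (abc-iut-L2-t1), and `hU` = the mod-`N`
content of print's "`F̈¹/F̈² = Hom((Δ^tp_Ÿ)^ell/Δ_Θ, Δ_Θ) = Ẑ·log(Ü)`" (Prop 1.5 (ii): `log(Ü)` is an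
ISOMORPHISM `(Δ^tp_Ÿ)^Θ/Δ_Θ ≅ Δ_Θ`) transported to `Ÿ̲̲` ("`Δ_X̲̲ = Im(s_ι)` maps isomorphically onto `Δ̄^ell_X`",
Prop 2.2 (ii) p.37, so `(Δ^tp_Ÿ̲̲)^Θ·Δ_Θ = (Δ^tp_Ÿ)^Θ`), which the typed `Prop15ii` does NOT carry (its module's
READING NOTES: the "`= Ẑ·log`" identifications are not typed). HONEST FRAMING: [EtTh] is refereed; these are
OUR kernel checks at the cell's §1 objects, conditional on the named §1 facts; no side is taken on [IUTchIII]
Cor 3.12; typed ≠ discharged elsewhere.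
-/

noncomputable section

namespace Literature.AnabelianGeometry.EtaleTheta

open Literature.AnabelianGeometry.SemiGraphs
open scoped IsMulCommutative

namespace ThetaSetting

variable {p : ℕ} [Fact p.Prime] {D : ThetaSetting p}

namespace EtaleThetaData

variable (E : D.EtaleThetaData)

/-- **The `Gal(Y/X)`-translate of the étale theta class, on `Ÿ`** (Prop 1.5 (iii) applied at `σ` and at
`x·σ`): `σ·η̈^Θ − (xσ)·η̈^Θ = infl(2b·log(Ü) + log(w))` in `H¹(Π^tp_Ÿ, Δ_Θ)` for some `w ∈ K̈^×`, `b` the image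
of `x` in `Z` (the two unit terms `log(O^×_K̈)` and the `q̈`-powers are Kummer classes). The `Ÿ`-form of
abc-iut-L2-t10's `conj_etaDd_div_eq` (which descends further to `Y` under `K = K̈`).
[cite: MochizukiEtTh2009, Prop 1.5 (iii) p.23] -/
theorem conj_etaDd_div_eq_infl_logUdd (hC : D.Compat) (h15 : Prop15iii E hC) (σ x : D.PiTemp) :
    ∃ w : (↥D.Kdd)ˣ,
      haveI := hC.GtpYdd_normal
      ContH1.conj D.toTheta D.DeltaTheta σ E.etaDd * (ContH1.conj D.toTheta D.DeltaTheta (x * σ) E.etaDd)⁻¹ =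
        D.inflTheta D.GtpYdd
          (E.logUdd ^ (2 * Multiplicative.toAdd (D.toZ x)) * E.kumYdd (E.toKddHat w)) := by
  haveI := hC.GtpYdd_normal
  haveI := hC.GtpYddTheta_normal
  obtain ⟨x', hx', hΦ⟩ := E.exists_lift_conj_eq hC h15
  obtain ⟨u, -, hu⟩ := hΦ σ
  obtain ⟨u', -, hu'⟩ := hΦ (x * σ)
  set a : ℤ := Multiplicative.toAdd (D.toZ σ) with ha
  set b : ℤ := Multiplicative.toAdd (D.toZ x) with hb
  have hab : Multiplicative.toAdd (D.toZ (x * σ)) = b + a := by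
    rw [map_mul, toAdd_mul]
  rw [hab] at hu'
  -- the unit of `K̈` collecting the `q̈`-powers and the two units
  set W : (↥D.Kdd)ˣ := D.qddUnit ^ ((b + a) * (b + a) - a * a) * (u * u'⁻¹) with hW
  refine ⟨W, ?_⟩
  have e1 : ContH1.conj D.toTheta D.DeltaTheta σ E.etaDd =
      D.inflTheta D.GtpYdd (ContH1.conj (MonoidHom.id D.GtpTheta) D.DeltaTheta (D.toTheta σ) x') := by
    rw [← hx']
    exact (ContH1.infl_conj (H₀ := D.GtpYdd) (H' := D.GtpYdd.map D.toTheta)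
      (hψ := D.continuous_toTheta) le_rfl σ x').symm
  have e2 : ContH1.conj D.toTheta D.DeltaTheta (x * σ) E.etaDd =
      D.inflTheta D.GtpYdd
        (ContH1.conj (MonoidHom.id D.GtpTheta) D.DeltaTheta (D.toTheta (x * σ)) x') := by
    rw [← hx']
    exact (ContH1.infl_conj (H₀ := D.GtpYdd) (H' := D.GtpYdd.map D.toTheta)
      (hψ := D.continuous_toTheta) le_rfl (x * σ) x').symm
  rw [e1, e2, hu, hu', ← map_inv (D.inflTheta D.GtpYdd), ← map_mul (D.inflTheta D.GtpYdd)]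
  congr 1
  rw [hW, map_mul, map_mul, map_zpow, map_mul, map_inv, map_zpow, map_mul, map_inv]
  apply (Additive.ofMul : D.H1Theta (D.GtpYdd.map D.toTheta) ≃ _).injective
  simp only [ofMul_mul, ofMul_inv, ofMul_zpow]
  module

end EtaleThetaData

namespace EtaleThetaData.DoubleUnderline

variable {E : D.EtaleThetaData} {l : ℕ} (C : E.DoubleUnderline l) {N : ℕ+} (μ : D.CyclotomeMod l N)

/-- **The arithmetic core of the upper bound** (Prop 2.14 (iii), p.51: "the third displayed formula of
Proposition 1.4, (ii) … implies … that for any `a·l ∈ Im_N` [where `a ∈ ℤ`], we have `2a ≡ 0 (mod N)`"), at the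
level of the root cocycles of `X̲̲`: let `f` be a cocycle of `η̲̈^{Θ,l·ℤ×μ₂}` and `x ∈ Π^tp_X̲̲` with image `a·l`
in `Z`, and suppose the reduction mod `N` of `f` is EXACTLY invariant under `x` on the geometric part
`Δ^tp_Ÿ̲̲` (`red(x̄·f(x⁻¹ g x)·x̄⁻¹) = red(f(g))` for `g ∈ Δ^tp_Ÿ̲̲`). By Prop 1.5 (iii) the class of
`(xσ·η̈^Θ)/(σ·η̈^Θ)` is `infl(−2al·log(Ü) + log(w))`, and Kummer classes and coboundaries vanish pointwise on
`Δ^tp_Ÿ` (Prop 1.5 (ii)); so `log(Ü)(g)^{2al} ∈ N·(l·Δ_Θ)` for every `g ∈ Δ^tp_Ÿ̲̲`, whence — GIVEN that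
`red ∘ (l·log(Ü))` maps `Δ^tp_Ÿ̲̲` ONTO `μ_N` (binder `hU`, the mod-`N` shadow of "`F̈¹/F̈² = Ẑ·log(Ü)`",
Prop 1.5 (ii)) — `N ∣ 2a`. [cite: MochizukiEtTh2009, Prop 2.14(iii) p.51] -/
theorem dvd_two_mul_zExp_of_red_conj_eq (hC : D.Compat) (h15 : Prop15iii E hC)
    (h15ii : Prop15ii E.toKummerData hC)
    {f : contCocycles D.toTheta D.DeltaTheta C.GtpYdduu} (hf : f ∈ C.rootCocycles hC) (x : C.Huu)
    (hinv : ∀ (g : C.GtpYdduu), (g : D.PiTemp) ∈ D.DeltaTemp →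
      μ.red ⟨D.toTheta (x : D.PiTemp) *
          (f.1 ⟨(x : D.PiTemp)⁻¹ * g * x, C.inv_mul_mul_mem_GtpYdduu hC x g⟩ : D.GtpTheta) *
          (D.toTheta (x : D.PiTemp))⁻¹, (D.lDeltaTheta_normal l).conj_mem _ (hf.1 _) _⟩ =
        μ.red ⟨f.1 g, hf.1 g⟩)
    (hU : ∃ c : contCocycles (MonoidHom.id D.GtpTheta) D.DeltaTheta (D.GtpYdd.map D.toTheta),
      (QuotientGroup.mk c : D.H1Theta (D.GtpYdd.map D.toTheta)) = E.logUdd ∧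
      ∀ m : MuN p N, ∃ (g : C.GtpYdduu) (_ : (g : D.PiTemp) ∈ D.DeltaTemp),
        μ.red ⟨((c.1 ⟨D.toTheta g, ⟨g, (Subgroup.mem_inf.1 g.2).1, rfl⟩⟩ ^ l : D.DeltaTheta) : D.GtpTheta),
          coe_pow_mem_lDeltaTheta l _⟩ = m) :
    (N : ℤ) ∣ 2 * C.zExp x := by
  haveI := hC.GtpYdd_normal
  haveI := hC.GtpYddTheta_normal
  obtain ⟨c, hcL, hcsurj⟩ := hU
  -- a cocycle `F = f₀` of `η̈^Θ` on `Π^tp_Ÿ`, and the orbit decomposition `f = (σ·F)| · ∂b`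
  obtain ⟨f₀, hf₀⟩ := QuotientGroup.mk_surjective E.etaDd
  obtain ⟨σ, hσ, b, hfb⟩ := C.exists_eq_conj_mul_cob_of_rootCocycle hC f₀.2 hf₀ hf
  set G₁ := ContH1.conjCocycle D.toTheta D.DeltaTheta σ f₀ with hG₁
  set G₂ := ContH1.conjCocycle D.toTheta D.DeltaTheta ((x : D.PiTemp) * σ) f₀ with hG₂
  set e : ℤ := 2 * Multiplicative.toAdd (D.toZ (x : D.PiTemp)) with he
  -- (1) the class of `G₁ · G₂⁻¹` is `infl(log(Ü)^e · log(w))` (Prop 1.5 (iii))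
  obtain ⟨w, hw⟩ := E.conj_etaDd_div_eq_infl_logUdd hC h15 σ (x : D.PiTemp)
  obtain ⟨κ, hκ⟩ := QuotientGroup.mk_surjective (E.kumYdd (E.toKddHat w))
  have hκF : (QuotientGroup.mk κ : D.H1Theta (D.GtpYdd.map D.toTheta)) ∈
      (Fdd2 : Subgroup (D.H1Theta (D.GtpYdd.map D.toTheta))) := by
    rw [hκ, h15ii.Fdd2_eq]; exact ⟨_, rfl⟩
  have hclass : (QuotientGroup.mk (ContH1.inflCocycle D.DeltaTheta D.toTheta D.continuous_toTheta
        (le_rfl : D.GtpYdd.map D.toTheta ≤ D.GtpYdd.map D.toTheta) (c ^ e * κ)) : D.H1 D.GtpYdd) =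
      QuotientGroup.mk (G₁ * G₂⁻¹) := by
    have h1 : (QuotientGroup.mk (G₁ * G₂⁻¹) : D.H1 D.GtpYdd) =
        ContH1.conj D.toTheta D.DeltaTheta σ E.etaDd *
          (ContH1.conj D.toTheta D.DeltaTheta ((x : D.PiTemp) * σ) E.etaDd)⁻¹ := by
      rw [← hf₀]; rfl
    rw [h1, hw, ← hcL, ← hκ]
    rfl
  obtain ⟨a, ha⟩ := ContH1.exists_coboundary_of_mk_eq _ _ hclass
  -- (2) pointwise on the geometric part: `G₁(g) · G₂(g)⁻¹ = log(Ü)(ḡ)^e`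
  have hpt : ∀ (g : C.GtpYdduu), (g : D.PiTemp) ∈ D.DeltaTemp →
      ((G₁.1 ⟨g, (Subgroup.mem_inf.1 g.2).1⟩ * (G₂.1 ⟨g, (Subgroup.mem_inf.1 g.2).1⟩)⁻¹ : D.DeltaTheta) :
          D.GtpTheta) =
        ((c.1 ⟨D.toTheta g, ⟨g, (Subgroup.mem_inf.1 g.2).1, rfl⟩⟩ : D.DeltaTheta) : D.GtpTheta) ^ e := by
    intro g hgΔ
    have haug : D.aug.toMonoidHom (g : D.PiTemp) = 1 := hgΔ
    have h1 := ha ⟨g, (Subgroup.mem_inf.1 g.2).1⟩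
    rw [cob_eq_one_of_aug_eq_one haug, mul_one] at h1
    have hκ1 : κ.1 ⟨D.toTheta g, ⟨g, (Subgroup.mem_inf.1 g.2).1, rfl⟩⟩ = 1 :=
      cocycle_apply_eq_one_of_mem_Fdd2 κ hκF _ ⟨g, Subgroup.mem_inf.2 ⟨(Subgroup.mem_inf.1 g.2).1, hgΔ⟩, rfl⟩
    have h2 : (ContH1.inflCocycle D.DeltaTheta D.toTheta D.continuous_toTheta
        (le_rfl : D.GtpYdd.map D.toTheta ≤ D.GtpYdd.map D.toTheta) (c ^ e * κ)).1
          ⟨g, (Subgroup.mem_inf.1 g.2).1⟩ =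
        c.1 ⟨D.toTheta g, ⟨g, (Subgroup.mem_inf.1 g.2).1, rfl⟩⟩ ^ e *
          κ.1 ⟨D.toTheta g, ⟨g, (Subgroup.mem_inf.1 g.2).1, rfl⟩⟩ := rfl
    rw [h2, hκ1, mul_one] at h1
    rw [← SubgroupClass.coe_zpow, ← h1]
    rfl
  -- (3) `f = G₁` and `x̄·f(x⁻¹ · x)·x̄⁻¹ = G₂` on the geometric part (`∂b` vanishes there)
  have hG₁f : ∀ (g : C.GtpYdduu), (g : D.PiTemp) ∈ D.DeltaTemp →
      f.1 g = G₁.1 ⟨g, (Subgroup.mem_inf.1 g.2).1⟩ := by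
    intro g hgΔ
    have haug : D.aug.toMonoidHom (g : D.PiTemp) = 1 := hgΔ
    rw [hfb g, cob_eq_one_of_aug_eq_one haug b, mul_one]
    exact (ContH1.conjCocycle_apply_eq σ f₀ _ _ rfl).symm
  have hG₂f : ∀ (g : C.GtpYdduu), (g : D.PiTemp) ∈ D.DeltaTemp →
      MulAut.conjNormal (D.toTheta (x : D.PiTemp))
          (f.1 ⟨(x : D.PiTemp)⁻¹ * g * x, C.inv_mul_mul_mem_GtpYdduu hC x g⟩) =
        G₂.1 ⟨g, (Subgroup.mem_inf.1 g.2).1⟩ := by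
    intro g hgΔ
    have haug : D.aug.toMonoidHom (g : D.PiTemp) = 1 := hgΔ
    have hgΔ' : (((⟨(x : D.PiTemp)⁻¹ * g * x, C.inv_mul_mul_mem_GtpYdduu hC x g⟩ : C.GtpYdduu) :
        D.PiTemp)) ∈ D.DeltaTemp := by
      change D.aug.toMonoidHom ((x : D.PiTemp)⁻¹ * g * x) = 1
      rw [map_mul, map_mul, map_inv, haug, mul_one, inv_mul_cancel]
    rw [hG₁f _ hgΔ', hG₁, hG₂, ContH1.conjCocycle_mul]
    exact (ContH1.conjCocycle_apply_eq (x : D.PiTemp) _ _ _ rfl).symm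
  -- (4) exact invariance mod `N` on the geometric part: `G₁(g) · G₂(g)⁻¹ ∈ N·(l·Δ_Θ)`
  have hred : ∀ (g : C.GtpYdduu), (g : D.PiTemp) ∈ D.DeltaTemp → ∃ y : D.lDeltaTheta l,
      ((G₁.1 ⟨g, (Subgroup.mem_inf.1 g.2).1⟩ * (G₂.1 ⟨g, (Subgroup.mem_inf.1 g.2).1⟩)⁻¹ : D.DeltaTheta) :
          D.GtpTheta) = ((y ^ (N : ℕ) : D.lDeltaTheta l) : D.GtpTheta) := by
    intro g hgΔ
    have hm1 : ((G₁.1 ⟨g, (Subgroup.mem_inf.1 g.2).1⟩ : D.DeltaTheta) : D.GtpTheta) ∈ D.lDeltaTheta l := by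
      rw [← hG₁f g hgΔ]; exact hf.1 g
    have hm2 : ((G₂.1 ⟨g, (Subgroup.mem_inf.1 g.2).1⟩ : D.DeltaTheta) : D.GtpTheta) ∈ D.lDeltaTheta l := by
      rw [← hG₂f g hgΔ, MulAut.conjNormal_apply]
      exact (D.lDeltaTheta_normal l).conj_mem _ (hf.1 _) _
    have v1 : ((G₁.1 ⟨g, (Subgroup.mem_inf.1 g.2).1⟩ : D.DeltaTheta) : D.GtpTheta) = (f.1 g : D.GtpTheta) := by
      rw [← hG₁f g hgΔ]
    have v2 : ((G₂.1 ⟨g, (Subgroup.mem_inf.1 g.2).1⟩ : D.DeltaTheta) : D.GtpTheta) =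
        D.toTheta (x : D.PiTemp) *
          (f.1 ⟨(x : D.PiTemp)⁻¹ * g * x, C.inv_mul_mul_mem_GtpYdduu hC x g⟩ : D.GtpTheta) *
          (D.toTheta (x : D.PiTemp))⁻¹ := by
      rw [← hG₂f g hgΔ, MulAut.conjNormal_apply]
    have h2 : μ.red ⟨_, hm1⟩ = μ.red ⟨_, hm2⟩ := by
      rw [CyclotomeMod.red_eq_of_val_eq μ hm1 (hf.1 g) v1,
        CyclotomeMod.red_eq_of_val_eq μ hm2 ((D.lDeltaTheta_normal l).conj_mem _ (hf.1 _) _) v2,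
        hinv g hgΔ]
    have h3 : μ.red ((⟨_, hm1⟩ : D.lDeltaTheta l) * (⟨_, hm2⟩ : D.lDeltaTheta l)⁻¹) = 1 := by
      rw [map_mul, map_inv, h2, mul_inv_cancel]
    obtain ⟨y, hy⟩ := (μ.red_ker _).1 h3
    exact ⟨y, congrArg Subtype.val hy⟩
  -- (5) hence `log(Ü)(ḡ)^{l·2a} ∈ N·(l·Δ_Θ)`, so `red(l·log(Ü)(ḡ))^{2a} = 1`
  have hpow : ∀ (g : C.GtpYdduu), (g : D.PiTemp) ∈ D.DeltaTemp →
      μ.red ⟨((c.1 ⟨D.toTheta g, ⟨g, (Subgroup.mem_inf.1 g.2).1, rfl⟩⟩ ^ l : D.DeltaTheta) : D.GtpTheta),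
          coe_pow_mem_lDeltaTheta l _⟩ ^ (2 * C.zExp x) = 1 := by
    intro g hgΔ
    obtain ⟨y, hy⟩ := hred g hgΔ
    rw [hpt g hgΔ] at hy
    have hu : (⟨((c.1 ⟨D.toTheta g, ⟨g, (Subgroup.mem_inf.1 g.2).1, rfl⟩⟩ ^ l : D.DeltaTheta) : D.GtpTheta),
        coe_pow_mem_lDeltaTheta l _⟩ : D.lDeltaTheta l) ^ (2 * C.zExp x) = y ^ (N : ℕ) := by
      apply Subtype.ext
      rw [SubgroupClass.coe_zpow, ← hy, SubmonoidClass.coe_pow, ← zpow_natCast, ← zpow_mul, he, C.toZ_eq x]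
      congr 1
      ring
    rw [← map_zpow, hu, map_pow]
    have h := pow_card_eq_one (G := MuN p N) (x := μ.red y)
    rwa [card_MuN] at h
  -- (6) `red ∘ (l·log(Ü))` is onto `μ_N` on `Δ^tp_Ÿ̲̲`: every `m ∈ μ_N` satisfies `m^{2a} = 1`, so `N ∣ 2a`
  have hall : ∀ m : MuN p N, m ^ (2 * C.zExp x) = 1 := fun m => by
    obtain ⟨g, hgΔ, hgm⟩ := hcsurj m
    rw [← hgm]
    exact hpow g hgΔ
  obtain ⟨g₀, hg₀⟩ := IsCyclic.exists_generator (α := MuN p N)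
  have ho : orderOf g₀ = N := by
    rw [orderOf_eq_card_of_forall_mem_zpowers hg₀, Nat.card_eq_fintype_card, card_MuN]
  have hdvd := (orderOf_dvd_iff_zpow_eq_one (x := g₀) (i := 2 * C.zExp x)).2 (hall g₀)
  rwa [ho] at hdvd

/-- **The `N†` form** ("`Im_N ⊆ (N†·l·ℤ) ⋊ {±1}` — where `N† = N` if `N` is odd, `N† = N/2` if `N` is even",
p.50; the divisibility `N†·l ∣ s` of the typed `RigidData.Prop214_iii_bi`): `N ∣ 2a` iff `a ∈ N†·ℤ`, so the image
`toZ(x) = a·l` of `x` is divisible by `N†·l`. [cite: MochizukiEtTh2009, Prop 2.14(iii) p.50] -/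
theorem ndag_mul_dvd_toZ_of_dvd_two_mul_zExp (x : C.Huu) (h : (N : ℤ) ∣ 2 * C.zExp x) :
    (if Odd (N : ℕ) then (N : ℤ) else (N : ℤ) / 2) * l ∣ Multiplicative.toAdd (D.toZ (x : D.PiTemp)) := by
  rw [C.toZ_eq x, mul_comm (l : ℤ)]
  split_ifs with hodd
  · refine mul_dvd_mul ?_ dvd_rfl
    have hcop : IsCoprime ((N : ℕ) : ℤ) ((2 : ℕ) : ℤ) :=
      Nat.isCoprime_iff_coprime.2 (Nat.coprime_two_right.2 hodd)
    have hcop' : IsCoprime ((N : ℕ) : ℤ) 2 := by simpa using hcop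
    exact hcop'.dvd_of_dvd_mul_left h
  · refine mul_dvd_mul ?_ dvd_rfl
    obtain ⟨k, hk⟩ := even_iff_two_dvd.1 (Nat.not_odd_iff_even.1 hodd)
    have hk' : ((N : ℕ) : ℤ) = 2 * k := by rw [hk]; push_cast; ring
    rw [hk'] at h ⊢
    rw [Int.mul_ediv_cancel_left _ two_ne_zero]
    exact (mul_dvd_mul_iff_left two_ne_zero).1 h

/-- **The binder `hU` from its `N`-free form.** If `log(Ü)` maps the geometric part `Δ^tp_Ÿ̲̲` ONTO `Δ_Θ`
(print: "`F̈¹/F̈² = Hom((Δ^tp_Ÿ)^ell/Δ_Θ, Δ_Θ) = Ẑ·log(Ü)`", Prop 1.5 (ii) p.23 — `log(Ü)` is an ISOMORPHISM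
`(Δ^tp_Ÿ)^Θ/Δ_Θ ≅ Δ_Θ` — together with "`Δ_X̲̲ = Im(s_ι)` maps isomorphically onto `Δ̄^ell_X`", Prop 2.2 (ii) p.37,
so that `(Δ^tp_Ÿ̲̲)^Θ · Δ_Θ = (Δ^tp_Ÿ)^Θ`), then for every level `N` and identification `μ_N ≅ (l·Δ_Θ) ⊗ ℤ/Nℤ`
the map `red ∘ (l·log(Ü))` is onto `μ_N` on `Δ^tp_Ÿ̲̲`. [cite: MochizukiEtTh2009, Prop 1.5 (ii) p.23] -/
theorem red_pow_logUdd_surjective_of_logUdd_surjective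
    (c : contCocycles (MonoidHom.id D.GtpTheta) D.DeltaTheta (D.GtpYdd.map D.toTheta))
    (hc : ∀ z : D.DeltaTheta, ∃ (g : C.GtpYdduu) (_ : (g : D.PiTemp) ∈ D.DeltaTemp),
      c.1 ⟨D.toTheta g, ⟨g, (Subgroup.mem_inf.1 g.2).1, rfl⟩⟩ = z)
    (m : MuN p N) :
    ∃ (g : C.GtpYdduu) (_ : (g : D.PiTemp) ∈ D.DeltaTemp),
      μ.red ⟨((c.1 ⟨D.toTheta g, ⟨g, (Subgroup.mem_inf.1 g.2).1, rfl⟩⟩ ^ l : D.DeltaTheta) : D.GtpTheta),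
        coe_pow_mem_lDeltaTheta l _⟩ = m := by
  obtain ⟨w, rfl⟩ := μ.red_surjective m
  obtain ⟨z, hz, hzw⟩ := w.2
  obtain ⟨g, hg, hgz⟩ := hc ⟨z, hz⟩
  refine ⟨g, hg, ?_⟩
  congr 1
  apply Subtype.ext
  change (((c.1 ⟨D.toTheta g, ⟨g, (Subgroup.mem_inf.1 g.2).1, rfl⟩⟩ ^ l : D.DeltaTheta)) : D.GtpTheta) =
    (w : D.GtpTheta)
  rw [hgz, SubmonoidClass.coe_pow]
  exact hzw

end EtaleThetaData.DoubleUnderline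

end ThetaSetting

end Literature.AnabelianGeometry.EtaleTheta

end
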